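import Mathlib
import HarnessLib
import Literature.Analysis.FluidPDE.ClassicalSolutionRegion
import Literature.Analysis.FluidPDE.ClassicalSuitableRegion
import Literature.Analysis.FluidPDE.VorticityStretching
import Literature.Analysis.FluidPDE.SpaceTimeCalculus
import Literature.Analysis.FluidPDE.TaoLocalVelocityGradient

/-!
# Crux `PoloidalWindowRigidity` (K2, stmt-NavierStokesRegularity-19708), line `local_rigidity`, stub `stub_localThickTH` —
# the FROZEN LAW of a LOCAL poloidal Navier–Stokes germ: `(ω·∇)u₂ = 0`, i.e. `∂₂u_h ∥ ∇ₕu₂`, on an open space–time region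

Cell ns-regularity-ideate, pool seat ns-poloidal-K2-p5 (stub-worker on `Cruxes/PoloidalWindowRigidity/Lines/local_rigidity.lean` v1,
stub S2 `stub_localThickTH`; `--supports stmt-NavierStokesRegularity-19708`).  The registered stub S2 quantifies over CLASS-FREE LOCAL
germs: a classical Navier–Stokes pair `(u, q)` on an OPEN space–time set `U` (`IsClassicalNSSolutionOnRegion U 1 0 u q`), poloidal along
`e₃` on `U`.  Its docstring asserts «on a non-degenerate poloidal NS germ the horizontal momentum equation alone gives a common analytic
slope `Λ` with `∂₂u_b = Λ ∂_b u₂`».  This file proves the kernel form of that first step for REGION solutions (the tree had it only for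
profiles of the Type-I class, through the mild formulation: `…FirstIntegral`, `…ErtelCollapse.poloidal_iff_frozen`):

* `exists_contDiff_localisation` — a region solution agrees, on an open neighbourhood `V ⊆ U` of any point, with a pair of GLOBALLY
  `C^∞` space–time fields (smooth cutoff; the tree's `ClassicalSuitableRegion` machinery);
* `stretching_two_eq_zero_of_contDiff` — for globally smooth fields satisfying the momentum equation and `ω₂ ≡ 0` on an open set `V`:
  `D(u t)(x)[ω(t,x)] · e₃ = 0` at every point of `V` (third component of the curl of the momentum equation: `∂ₜω₂`, `Δω₂`, `(u·∇)ω₂`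
  and `(div u)ω₂` vanish because `ω₂ ≡ 0` on the open set, the pressure drops out, and what is left is the stretching `(ω·∇)u₂`);
* `stretching_two_eq_zero` — the same for a REGION solution `IsClassicalNSSolutionOnRegion U ν 0 u q`, `U` open, poloidal on `U`;
* `vertShear_wedge_horizGrad_eq_zero` — the determinant form used by the stubs: `∂₂u₀·∂₁u₂ − ∂₂u₁·∂₀u₂ = 0` on `U`, i.e. the vertical
  shear `∂₂u_h` is parallel to the horizontal gradient `∇ₕu₂` (hypothesis `⟪curl u, e₃⟫ = 0` verbatim as in `stub_localThickTH`).

No incompressibility, analyticity, decay or time direction is used: the law is the `e₃`-component of the vorticity equation.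
WHAT THIS IS NOT: not a proof of the stub, of the crux, or of anything about Navier–Stokes regularity — the first (kinematic-dynamic)
reduction step of S2, for local germs.
-/

noncomputable section

-- the summit and its single sub-problem share the name (CONVENTIONS §1), as in every Theorems file
set_option linter.dupNamespace false

namespace Summit.NavierStokesRegularity.NavierStokesRegularity.Theorems.PoloidalWindowDoorPoloidalWindowRigidityLocalFrozenLaw

open Set Function Filter Topology Metric
open scoped RealInnerProductSpace InnerProductSpace Laplacian ContDiff
open Literature.Analysis Literature.Analysis.FluidPDE

variable {U : Set (ℝ × (EuclideanSpace ℝ (Fin 3)))} {ν : ℝ} {u : ℝ → (EuclideanSpace ℝ (Fin 3)) → (EuclideanSpace ℝ (Fin 3))} {q : ℝ → (EuclideanSpace ℝ (Fin 3)) → ℝ}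

/-! ### §1  Smooth localisation of a region solution -/

/-- **Smooth localisation.**  A classical solution `(u, q)` on an open region `U` agrees, on some open `V` with `p ∈ V ⊆ U`, with a
pair `(v, r)` of space–time fields that are `C^∞` on ALL of `ℝ × (EuclideanSpace ℝ (Fin 3))` (multiply by a smooth cutoff `χ ≡ 1` near `p` with
`tsupport χ ⊆ U`). -/
theorem exists_contDiff_localisation {f : ℝ → (EuclideanSpace ℝ (Fin 3)) → (EuclideanSpace ℝ (Fin 3))} (hU : IsOpen U) (h : IsClassicalNSSolutionOnRegion U ν f u q)
    {p : ℝ × (EuclideanSpace ℝ (Fin 3))} (hp : p ∈ U) :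
    ∃ (v : ℝ → (EuclideanSpace ℝ (Fin 3)) → (EuclideanSpace ℝ (Fin 3))) (r : ℝ → (EuclideanSpace ℝ (Fin 3)) → ℝ) (V : Set (ℝ × (EuclideanSpace ℝ (Fin 3)))),
      ContDiff ℝ ∞ (uncurry v) ∧ ContDiff ℝ ∞ (uncurry r) ∧ IsOpen V ∧ p ∈ V ∧ V ⊆ U ∧
      (∀ z ∈ V, v z.1 z.2 = u z.1 z.2) ∧ (∀ z ∈ V, r z.1 z.2 = q z.1 z.2) := by
  obtain ⟨χ, hχ, -, hχU, hχ1⟩ :=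
    exists_contDiff_tsupport_subset_eventuallyEq_one (isCompact_singleton (x := p)) hU (singleton_subset_iff.2 hp)
  refine ⟨fun t x => χ (t, x) • u t x, fun t x => χ (t, x) • q t x, interior {z | χ z = 1} ∩ U, ?_, ?_,
    isOpen_interior.inter hU, ⟨subset_interior_setOf_eq_one hχ1 (mem_singleton p), hp⟩, inter_subset_right, ?_, ?_⟩
  · rw [uncurry_cutoff_smul]
    exact contDiff_cutoff_smul_of_contDiffOn hU hχ hχU h.smooth_velocity
  · rw [uncurry_cutoff_smul]
    exact contDiff_cutoff_smul_of_contDiffOn hU hχ hχU h.smooth_pressure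
  · intro z hz
    have h1 : χ z = 1 := interior_subset (s := {w : ℝ × (EuclideanSpace ℝ (Fin 3)) | χ w = 1}) hz.1
    have hz' : χ (z.1, z.2) = 1 := by simpa using h1
    simp [hz']
  · intro z hz
    have h1 : χ z = 1 := interior_subset (s := {w : ℝ × (EuclideanSpace ℝ (Fin 3)) | χ w = 1}) hz.1
    have hz' : χ (z.1, z.2) = 1 := by simpa using h1
    simp [hz']

/-! ### §2  The frozen law `(ω·∇)u₂ = 0` -/

/-- Components of a difference in `(EuclideanSpace ℝ (Fin 3))` (bookkeeping). -/
private theorem sub_apply₃ (a b : (EuclideanSpace ℝ (Fin 3))) (i : Fin 3) : (a - b) i = a i - b i := rfl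
/-- Components of a sum in `(EuclideanSpace ℝ (Fin 3))` (bookkeeping). -/
private theorem add_apply₃ (a b : (EuclideanSpace ℝ (Fin 3))) (i : Fin 3) : (a + b) i = a i + b i := rfl
/-- Components of a scalar multiple in `(EuclideanSpace ℝ (Fin 3))` (bookkeeping). -/
private theorem smul_apply₃ (c : ℝ) (a : (EuclideanSpace ℝ (Fin 3))) (i : Fin 3) : (c • a) i = c * a i := rfl

/-- Coordinates of the Laplacian of a vector field: `(ΔF)ᵢ = Δ(Fᵢ)` (Mathlib `ContDiffAt.laplacian_CLM_comp_left`). -/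
theorem laplacian_apply_coord {F : (EuclideanSpace ℝ (Fin 3)) → (EuclideanSpace ℝ (Fin 3))} {x : (EuclideanSpace ℝ (Fin 3))} (hF : ContDiffAt ℝ 2 F x) (i : Fin 3) :
    (Δ F) x i = (Δ fun y => F y i) x := by
  have h : (fun y => F y i) = (EuclideanSpace.proj i : (EuclideanSpace ℝ (Fin 3)) →L[ℝ] ℝ) ∘ F := rfl
  rw [h, hF.laplacian_CLM_comp_left]
  rfl

/-- The `e₃`-component of the curl depends only on the Jacobian: `(curl F x)₂ = DF(x)e₀·e₁ − DF(x)e₁·e₀`. -/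
theorem curl_apply_two' (F : (EuclideanSpace ℝ (Fin 3)) → (EuclideanSpace ℝ (Fin 3))) (x : (EuclideanSpace ℝ (Fin 3))) :
    curl F x 2 = fderiv ℝ F x (EuclideanSpace.single 0 1) 1 - fderiv ℝ F x (EuclideanSpace.single 1 1) 0 := by
  simp [curl]

/-- **The frozen law for globally smooth fields (pointwise core).**  Let `v`, `r` be `C^∞` space–time fields on all of `ℝ × (EuclideanSpace ℝ (Fin 3))`
which satisfy the momentum equation `∂ₜv + (v·∇)v = νΔv − ∇r` and `ω₂ = (curl v)₂ = 0` at every point of an OPEN set `V`.  Then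
the vertical component of the vortex stretching vanishes on `V`: `Dv(t)(x)[ω(t,x)]·e₃ = 0`.  Proof: the `e₃`-component of the curl
of the momentum equation at `(t,x)`; `curl ∇r = 0`, `curl Δ = Δ curl`, `curl((v·∇)v) = (v·∇)ω − (ω·∇)v + (div v)ω`
(tree: `curl_gradient_eq_zero_holds`, `curl_laplacian`, `curl_convect_self`), `∂ₜ` commutes with `D` (tree:
`IsSmoothSpaceTimeOn.hasDerivAt_fderiv_slice_clm`), and `∂ₜω₂ = Δω₂ = (v·∇)ω₂ = (div v)ω₂ = 0` because `ω₂ ≡ 0` near `(t,x)`. -/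
theorem stretching_two_eq_zero_of_contDiff {v : ℝ → (EuclideanSpace ℝ (Fin 3)) → (EuclideanSpace ℝ (Fin 3))} {r : ℝ → (EuclideanSpace ℝ (Fin 3)) → ℝ} {V : Set (ℝ × (EuclideanSpace ℝ (Fin 3)))}
    (hv : ContDiff ℝ ∞ (uncurry v)) (hr : ContDiff ℝ ∞ (uncurry r)) (hV : IsOpen V)
    (hmom : ∀ z ∈ V, deriv (fun s => v s z.2) z.1 + convect (v z.1) (v z.1) z.2 =
        ν • (Δ (v z.1)) z.2 - gradient (r z.1) z.2)
    (hpol : ∀ z ∈ V, curl (v z.1) z.2 2 = 0) {z : ℝ × (EuclideanSpace ℝ (Fin 3))} (hz : z ∈ V) :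
    fderiv ℝ (v z.1) z.2 (curl (v z.1) z.2) 2 = 0 := by
  obtain ⟨t, x⟩ := z
  -- smoothness bookkeeping
  have hvs : IsSmoothSpaceTimeOn univ v := by
    rw [IsSmoothSpaceTimeOn, univ_prod_univ]; exact hv.contDiffOn
  have hrs : IsSmoothSpaceTimeOn univ r := by
    rw [IsSmoothSpaceTimeOn, univ_prod_univ]; exact hr.contDiffOn
  have hvt : ContDiff ℝ ∞ (v t) := hvs.contDiff_slice (mem_univ t)
  have hrt : ContDiff ℝ ∞ (r t) := hrs.contDiff_slice (mem_univ t)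
  have hv3 : ContDiff ℝ 3 (v t) := hvt.of_le (by norm_cast)
  have hv2 : ContDiff ℝ 2 (v t) := hvt.of_le (by norm_cast)
  have hr2 : ContDiff ℝ 2 (r t) := hrt.of_le (by norm_cast)
  have hΔ : ContDiff ℝ ∞ fun y => (Δ (v t)) y := (hvs.laplacian uniqueDiffOn_univ).contDiff_slice (mem_univ t)
  have hG : ContDiff ℝ ∞ fun y => convect (v t) (v t) y := (hvs.convect hvs uniqueDiffOn_univ).contDiff_slice (mem_univ t)
  have hgrad : ContDiff ℝ ∞ fun y => gradient (r t) y := (hrs.gradient uniqueDiffOn_univ).contDiff_slice (mem_univ t)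
  have hT : ContDiff ℝ ∞ fun y => deriv (fun s => v s y) t := by
    have h1 := (hvs.timeDerivWithin uniqueDiffOn_univ).contDiff_slice (mem_univ t)
    have e : (fun y => deriv (fun s => v s y) t) = timeDerivWithin univ v t := by
      funext y; simp [timeDerivWithin_apply, derivWithin_univ]
    rw [e]; exact h1
  have hω : ContDiff ℝ 2 (curl (v t)) := contDiff_curl (n := 2) (by exact_mod_cast hv3)
  -- the slice `{y | (t,y) ∈ V}` and the time line `{s | (s,x) ∈ V}` are open neighbourhoods
  have hVt : {y : (EuclideanSpace ℝ (Fin 3)) | (t, y) ∈ V} ∈ 𝓝 x := (hV.preimage (Continuous.prodMk_right t)).mem_nhds hz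
  have hVx : {s : ℝ | (s, x) ∈ V} ∈ 𝓝 t := (hV.preimage (Continuous.prodMk_left x)).mem_nhds hz
  have hω0 : (fun y => curl (v t) y 2) =ᶠ[𝓝 x] fun _ => (0 : ℝ) := by
    filter_upwards [hVt] with y hy using hpol (t, y) hy
  have hω0t : (fun s => curl (v s) x 2) =ᶠ[𝓝 t] fun _ => (0 : ℝ) := by
    filter_upwards [hVx] with s hs using hpol (s, x) hs
  -- the momentum equation as an identity of slice germs at `x`
  set F₁ : (EuclideanSpace ℝ (Fin 3)) → (EuclideanSpace ℝ (Fin 3)) := fun y => deriv (fun s => v s y) t + convect (v t) (v t) y with hF₁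
  set F₂ : (EuclideanSpace ℝ (Fin 3)) → (EuclideanSpace ℝ (Fin 3)) := fun y => ν • (Δ (v t)) y - gradient (r t) y with hF₂
  have hF : F₁ =ᶠ[𝓝 x] F₂ := by
    filter_upwards [hVt] with y hy using hmom (t, y) hy
  have hcurl : curl F₁ x 2 = curl F₂ x 2 := by rw [curl_congr_of_eventuallyEq hF]
  -- right-hand side: `(curl (νΔv − ∇r))₂ = ν (Δ ω)₂ = ν Δ(ω₂) = 0`
  have hR : curl F₂ x 2 = 0 := by
    have dΔ : DifferentiableAt ℝ (fun y => ν • (Δ (v t)) y) x := ((hΔ.differentiable (by simp)) x).const_smul ν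
    have dgrad : DifferentiableAt ℝ (fun y => gradient (r t) y) x := (hgrad.differentiable (by simp)) x
    have e1 : curl F₂ x = ν • curl (Δ (v t)) x - curl (fun y => gradient (r t) y) x := by
      rw [hF₂, curl_sub dΔ dgrad, curl_const_smul ((hΔ.differentiable (by simp)) x) ν]
    have e2 : curl (fun y => gradient (r t) y) x = 0 := curl_gradient_eq_zero_holds _ hr2 x
    have e3 : curl (Δ (v t)) x = (Δ (curl (v t))) x := curl_laplacian hv3 x
    have e4 : (Δ (curl (v t))) x 2 = (Δ fun y => curl (v t) y 2) x :=
      laplacian_apply_coord hω.contDiffAt 2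
    have e5 : (Δ fun y => curl (v t) y 2) x = 0 := by
      rw [(InnerProductSpace.laplacian_congr_nhds hω0).self_of_nhds]
      simp [InnerProductSpace.laplacian_const]
    rw [e1, sub_apply₃, smul_apply₃, e2, e3, e4, e5]
    simp
  -- left-hand side: `(curl ∂ₜv)₂ = ∂ₜ ω₂ = 0` and `(curl (v·∇)v)₂ = (v·∇)ω₂ − (ω·∇)v₂ + (div v) ω₂ = −(ω·∇)v₂`
  have hL : curl F₁ x 2 = - fderiv ℝ (v t) x (curl (v t) x) 2 := by
    have dT : DifferentiableAt ℝ (fun y => deriv (fun s => v s y) t) x := (hT.differentiable (by simp)) x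
    have dG : DifferentiableAt ℝ (fun y => convect (v t) (v t) y) x := (hG.differentiable (by simp)) x
    have e1 : curl F₁ x = curl (fun y => deriv (fun s => v s y) t) x + curl (fun y => convect (v t) (v t) y) x := by
      rw [hF₁, curl_add dT dG]
    -- time derivative term
    have e2 : curl (fun y => deriv (fun s => v s y) t) x 2 = 0 := by
      have hA := hvs.hasDerivAt_fderiv_slice_clm isOpen_univ (mem_univ t) x
      -- compose the CLM-valued time line with the continuous linear functional `L ↦ (curlCLM L) 2`
      set ℓ : ((EuclideanSpace ℝ (Fin 3)) →L[ℝ] (EuclideanSpace ℝ (Fin 3))) →L[ℝ] ℝ := (EuclideanSpace.proj (2 : Fin 3) : (EuclideanSpace ℝ (Fin 3)) →L[ℝ] ℝ).comp curlCLM with hℓ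
      have hB : HasDerivAt (fun s => ℓ (fderiv ℝ (v s) x)) (ℓ (fderiv ℝ (fun y => deriv (fun s => v s y) t) x)) t :=
        ℓ.hasFDerivAt.comp_hasDerivAt t hA
      have hℓv : ∀ (G : (EuclideanSpace ℝ (Fin 3)) → (EuclideanSpace ℝ (Fin 3))), ℓ (fderiv ℝ G x) = curl G x 2 := fun G => by
        rw [hℓ, ContinuousLinearMap.comp_apply, ← curl_eq_curlCLM]; rfl
      have hB' : HasDerivAt (fun s => curl (v s) x 2) (curl (fun y => deriv (fun s => v s y) t) x 2) t := by
        have := hB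
        simp only [hℓv] at this
        exact this
      rw [← hB'.deriv, hω0t.deriv_eq, deriv_const]
    -- convective term
    have e3 : curl (fun y => convect (v t) (v t) y) x 2 = - fderiv ℝ (v t) x (curl (v t) x) 2 := by
      have e := curl_convect_self hv2 x
      have e' : curl (fun y => convect (v t) (v t) y) x = curl (convect (v t) (v t)) x := rfl
      rw [e', e, add_apply₃, sub_apply₃, smul_apply₃, convect_apply, convect_apply]
      have hd : DifferentiableAt ℝ (curl (v t)) x := (hω.differentiable (by norm_cast)) x
      have f1 : fderiv ℝ (curl (v t)) x (v t x) 2 = fderiv ℝ (fun y => curl (v t) y 2) x (v t x) :=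
        (fderiv_apply_coord hd (v t x) 2).symm
      have f2 : fderiv ℝ (fun y => curl (v t) y 2) x = 0 := by
        rw [hω0.fderiv_eq]; simp
      have f3 : curl (v t) x 2 = 0 := hpol (t, x) hz
      rw [f1, f2, f3]
      simp
    rw [e1, add_apply₃, e2, e3, zero_add]
  -- conclude
  have := hcurl
  rw [hL, hR] at this
  linarith

/-- **The frozen law for a LOCAL poloidal Navier–Stokes germ.**  Let `(u, q)` be a classical Navier–Stokes pair with viscosity
`ν` and no force on an OPEN space–time region `U` (`IsClassicalNSSolutionOnRegion U ν 0 u q`), poloidal along `e₃` on `U`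
(`(curl u)₂ = 0`).  Then at every point of `U` the vertical component of the vortex stretching vanishes,
`D(u t)(x)[curl u(t,x)] · e₃ = 0` — the `e₃`-component of the vorticity equation.  (Localise with `exists_contDiff_localisation`,
transfer the momentum equation and `ω₂ = 0` to the smooth representative on the open set `V`, apply the pointwise core, transfer
back: all quantities are germ-determined.) -/
theorem stretching_two_eq_zero (hU : IsOpen U) (h : IsClassicalNSSolutionOnRegion U ν 0 u q)
    (hpol : ∀ p ∈ U, curl (u p.1) p.2 2 = 0) {p : ℝ × (EuclideanSpace ℝ (Fin 3))} (hp : p ∈ U) :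
    fderiv ℝ (u p.1) p.2 (curl (u p.1) p.2) 2 = 0 := by
  obtain ⟨v, r, V, hv, hr, hV, hpV, hVU, hvu, hrq⟩ := exists_contDiff_localisation hU h hp
  have hgerm : ∀ z ∈ V, uncurry v =ᶠ[𝓝 z] uncurry u := fun z hz => by
    filter_upwards [hV.mem_nhds hz] with w hw using hvu w hw
  have hgerm' : ∀ z ∈ V, uncurry r =ᶠ[𝓝 z] uncurry q := fun z hz => by
    filter_upwards [hV.mem_nhds hz] with w hw using hrq w hw
  have hmom : ∀ z ∈ V, deriv (fun s => v s z.2) z.1 + convect (v z.1) (v z.1) z.2 =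
      ν • (Δ (v z.1)) z.2 - gradient (r z.1) z.2 := by
    intro z hz
    have e := h.momentum_deriv hU (hVU hz)
    have h1 : deriv (fun s => v s z.2) z.1 = deriv (fun s => u s z.2) z.1 :=
      (eventuallyEq_timeLine_of_eventuallyEq_uncurry (hgerm z hz)).deriv_eq
    have h2 : fderiv ℝ (v z.1) z.2 = fderiv ℝ (u z.1) z.2 := fderiv_slice_congr_of_eventuallyEq (hgerm z hz)
    have h4 : (Δ (v z.1)) z.2 = (Δ (u z.1)) z.2 :=
      (InnerProductSpace.laplacian_congr_nhds (eventuallyEq_slice_of_eventuallyEq_uncurry (hgerm z hz))).self_of_nhds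
    have h5 : gradient (r z.1) z.2 = gradient (q z.1) z.2 := by
      unfold gradient; rw [fderiv_slice_congr_of_eventuallyEq (hgerm' z hz)]
    rw [convect_apply, h1, h2, hvu z hz, h4, h5, ← convect_apply]
    simpa using e
  have hpolV : ∀ z ∈ V, curl (v z.1) z.2 2 = 0 := by
    intro z hz
    rw [curl_congr_of_eventuallyEq (eventuallyEq_slice_of_eventuallyEq_uncurry (hgerm z hz))]
    exact hpol z (hVU hz)
  have key := stretching_two_eq_zero_of_contDiff hv hr hV hmom hpolV hpV
  rwa [fderiv_slice_congr_of_eventuallyEq (hgerm p hpV),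
    curl_congr_of_eventuallyEq (eventuallyEq_slice_of_eventuallyEq_uncurry (hgerm p hpV))] at key

/-! ### §3  Determinant form: the vertical shear is parallel to the horizontal gradient of `u₂` -/

/-- **`∂₂u_h ∥ ∇ₕu₂` on a local poloidal NS germ** — the form used by the K2 stubs (`stub_twisting`, `stub_localThickTH`):
for a classical Navier–Stokes pair on an open region `U`, poloidal along `e₃` on `U` (hypothesis `⟪curl u, e₃⟫ = 0` verbatim as in
`stub_localThickTH`), at every point of `U`
`∂₂u₀ · ∂₁u₂ − ∂₂u₁ · ∂₀u₂ = 0`.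
Indeed `D(u)[ω]·e₃ = ω₀∂₀u₂ + ω₁∂₁u₂ + ω₂∂₂u₂` with `ω = (∂₁u₂ − ∂₂u₁, ∂₂u₀ − ∂₀u₂, 0)`.  Consequently, wherever `∇ₕu₂ ≠ 0`
(the stub's non-degeneracy), `∂₂u_b = Λ ∂_b u₂` (`b = 0,1`) with the single scalar `Λ = ⟨∂₂u_h, ∇ₕu₂⟩/|∇ₕu₂|²`. -/
theorem vertShear_wedge_horizGrad_eq_zero (hU : IsOpen U) (h : IsClassicalNSSolutionOnRegion U ν 0 u q)
    (hpol : ∀ p ∈ U, ⟪curl (u p.1) p.2, EuclideanSpace.single 2 (1 : ℝ)⟫_ℝ = 0) {p : ℝ × (EuclideanSpace ℝ (Fin 3))} (hp : p ∈ U) :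
    fderiv ℝ (u p.1) p.2 (EuclideanSpace.single 2 1) 0 * fderiv ℝ (u p.1) p.2 (EuclideanSpace.single 1 1) 2 -
      fderiv ℝ (u p.1) p.2 (EuclideanSpace.single 2 1) 1 * fderiv ℝ (u p.1) p.2 (EuclideanSpace.single 0 1) 2 = 0 := by
  have hpol' : ∀ p ∈ U, curl (u p.1) p.2 2 = 0 := fun p hp => by
    simpa [EuclideanSpace.inner_single_right] using hpol p hp
  have key := stretching_two_eq_zero hU h hpol' hp
  rw [clm_apply_coord (fderiv ℝ (u p.1) p.2) (curl (u p.1) p.2) 2, Fin.sum_univ_three, hpol' p hp] at key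
  have h0 : curl (u p.1) p.2 0 = fderiv ℝ (u p.1) p.2 (EuclideanSpace.single 1 1) 2 -
      fderiv ℝ (u p.1) p.2 (EuclideanSpace.single 2 1) 1 := by simp [curl]
  have h1 : curl (u p.1) p.2 1 = fderiv ℝ (u p.1) p.2 (EuclideanSpace.single 2 1) 0 -
      fderiv ℝ (u p.1) p.2 (EuclideanSpace.single 0 1) 2 := by simp [curl]
  rw [h0, h1] at key
  linear_combination key

/-- **The slope law, packaged as in the stubs.**  Under the hypotheses of `vertShear_wedge_horizGrad_eq_zero`, if at `p ∈ U` the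
horizontal gradient of `u₂` does not vanish, then with `Λ := (∂₂u₀∂₀u₂ + ∂₂u₁∂₁u₂)/(∂₀u₂² + ∂₁u₂²)` one has `∂₂u_b = Λ ∂_b u₂` for
`b = 0, 1` — the «common slope» of the docstring of `stub_localThickTH` (there: THICK ⇔ `Λ` is not a function of `(t, x₂)` on any
open subset). -/
theorem vertShear_eq_slope_mul (hU : IsOpen U) (h : IsClassicalNSSolutionOnRegion U ν 0 u q)
    (hpol : ∀ p ∈ U, ⟪curl (u p.1) p.2, EuclideanSpace.single 2 (1 : ℝ)⟫_ℝ = 0) {p : ℝ × (EuclideanSpace ℝ (Fin 3))} (hp : p ∈ U)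
    (hnd : fderiv ℝ (u p.1) p.2 (EuclideanSpace.single 0 1) 2 ≠ 0 ∨ fderiv ℝ (u p.1) p.2 (EuclideanSpace.single 1 1) 2 ≠ 0)
    (b : Fin 3) (hb : b ≠ 2) :
    fderiv ℝ (u p.1) p.2 (EuclideanSpace.single 2 1) b =
      (fderiv ℝ (u p.1) p.2 (EuclideanSpace.single 2 1) 0 * fderiv ℝ (u p.1) p.2 (EuclideanSpace.single 0 1) 2 +
          fderiv ℝ (u p.1) p.2 (EuclideanSpace.single 2 1) 1 * fderiv ℝ (u p.1) p.2 (EuclideanSpace.single 1 1) 2) /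
        (fderiv ℝ (u p.1) p.2 (EuclideanSpace.single 0 1) 2 ^ 2 + fderiv ℝ (u p.1) p.2 (EuclideanSpace.single 1 1) 2 ^ 2) *
      fderiv ℝ (u p.1) p.2 (EuclideanSpace.single b 1) 2 := by
  have key := vertShear_wedge_horizGrad_eq_zero hU h hpol hp
  set a0 := fderiv ℝ (u p.1) p.2 (EuclideanSpace.single 2 1) 0
  set a1 := fderiv ℝ (u p.1) p.2 (EuclideanSpace.single 2 1) 1
  set g0 := fderiv ℝ (u p.1) p.2 (EuclideanSpace.single 0 1) 2
  set g1 := fderiv ℝ (u p.1) p.2 (EuclideanSpace.single 1 1) 2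
  have hpos : g0 ^ 2 + g1 ^ 2 ≠ 0 := by
    rcases hnd with h0 | h1
    · have : 0 < g0 ^ 2 := by positivity
      positivity
    · have : 0 < g1 ^ 2 := by positivity
      positivity
  have hb' : b = 0 ∨ b = 1 := by
    fin_cases b
    · exact Or.inl rfl
    · exact Or.inr rfl
    · exact absurd rfl hb
  rcases hb' with rfl | rfl
  · field_simp
    linear_combination g1 * key
  · field_simp
    linear_combination (-g0) * key

end Summit.NavierStokesRegularity.NavierStokesRegularity.Theorems.PoloidalWindowDoorPoloidalWindowRigidityLocalFrozenLaw

end
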